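import Summits.Ventures.HSemireg.ComplexAtiyahPower
import Summits.Ventures.HSemireg.DerivedDescentBaseChangeMul
import Literature.AlgebraicGeometry.HodgeTheory.TwistJetPushforwardIso
import Literature.AlgebraicGeometry.Modules.SheafHomPushforwardLeft
import Mathlib.Algebra.Homology.DerivedCategory.Ext.Map
import HarnessLib

/-!
# Venture HSemireg — the complex Atiyah powers `ι• · At(K•)^q` along an isomorphism of `S`-schemes
# (piece (N4) of `HomComplex.IsISemiregularC.of_schemeIso`)

research route conditional on HC_CM; not a corollary; Q11.4-sentence-2 already refuted in dim ≥ 3.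

HONEST FRAMING. Kernel bookkeeping on the cell's real carriers (p3's `complexAtiyahStep` / `complexAtiyahPower` /
`toTwistHodgeZeroC` / `extMulAtiyahPower` of `ComplexAtiyahClass.lean`, the argument `x · ι• · At(K•)^q` of t-7's `σ_q`); nothing about
any variety; nothing here says HC, HC_CM or HC_AV is proved. Seat ring2-b06 gen 119, banked by-name support target
`HomComplex.IsISemiregularC.of_schemeIso` of crux stmt-HodgeConjecture-19787 (ring2 LEAD 152 ruling L152.5 (R3)). This is the
complex-level twin of the tree's module-level `TwistJetPushforwardIso.mapExactFunctor_atiyahClassPower`. For an isomorphism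
`e : X₀ ≅ X₁` of `S`-schemes, `e_* := pushforward e.hom.left` (an equivalence), `e_*•` termwise, `e_{**}` := gen 118's `mapShiftedHom e_*`
(the action of `D(e_*)` on shifted Homs of complexes, `DerivedDescentBaseChange.lean`), and a cochain complex `K` of `𝒪_{X₀}`-modules:

* §1 the module-level comparisons `α_j : e_*(E ⊗ Ωʲ) ≅ e_*E ⊗ Ωʲ` (`twistHodgePushforwardIso`) and `e_* Pʲ(E) ≅ Pʲ(e_*E)`
  (`twistJetPushforwardIso`) are NATURAL in `E` (`map_twistHodgeFunctor_map_comp_twistHodgePushforwardIso_hom`, module algebra on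
  `sheafHomPushforwardIso`; `map_twistJetFunctor_map_comp_twistJetPushforwardIso_hom`, on sections);
* §2 hence chain isomorphisms `twistHodgeComplexPushforwardIso e j K : e_*•(K ⊗ Ωʲ) ≅ (e_*•K) ⊗ Ωʲ` and
  `twistJetComplexPushforwardIso e j K : e_*• Pʲ(K) ≅ Pʲ(e_*•K)`, assembling to a morphism of the termwise twisted Atiyah sequences
  `e_*•(0 → K⊗Ωʲ⁺¹ → Pʲ(K) → K⊗Ωʲ → 0) ⟶ (same for e_*•K)` (`twistJetComplexShortComplexPushforwardHom`);
* §3 **`mapShiftedHom_complexAtiyahStep`** — `e_{**}(At_j(K)) = δ(e_*•(Atiyah sequence))` (Mathlib `DerivedCategory.map_triangleOfSESδ`)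
  and **`mapShiftedHom_complexAtiyahStep_comp`** — `e_{**}(At_j(K)) · [Q α_{j+1}] = [Q α_j] · At_j(e_*•K)` (`triangleOfSESδ_naturality`);
  by induction **`mapShiftedHom_complexAtiyahPower_comp`** — `e_{**}(At(K)^q) · [Q α_q] = [Q α_0] · At(e_*•K)^q`;
* §4 `map_toTwistHodgeZeroC_comp` — `e_*•(ι•_K) ≫ α_0 = ι•_{e_*•K}` (termwise `map_toTwistHodgeZero_comp`); hence
  **`mapShiftedHom_complexAtiyahPowerFrom_comp`** and **`mapShiftedHom_extMulAtiyahPower_comp`** —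
  `e_{**}(x · ι• · At(K)^q) · [Q α_q] = e_{**}(x) · ι• · At(e_*•K)^q`.

References: R.-O. Buchweitz, H. Flenner, Compositio Math. 137 (2003), §3 (Atiyah class of a complex), Def. 4.1 [BuchweitzFlenner2003];
M. F. Atiyah, Trans. AMS 85 (1957), §4 Prop. 6–7 [Atiyah1957]; R. Hartshorne (1977), II Ex. 5.1, II §5 pp. 109–110 [Hartshorne1977];
C. A. Weibel (1994), §10.4, Example 10.4.9 (exact functors and connecting morphisms) [Weibel1994]. Bookkeeping along an
isomorphism (reading; no printed statement is typed verbatim).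
-/

noncomputable section

-- `TopCat.Presheaf`/`Scheme.Modules` are not reducible (as in Mathlib's `AlgebraicGeometry/Modules/Sheaf.lean`).
set_option backward.isDefEq.respectTransparency false

open CategoryTheory CategoryTheory.Category CategoryTheory.Limits AlgebraicGeometry Opposite
open AlgebraicGeometry.Scheme.Modules DerivedCategory

universe w₀ w₁ u

namespace Summit.Ventures.HSemireg

open Literature.AlgebraicGeometry.Modules Literature.AlgebraicGeometry.Motives
open Literature.AlgebraicGeometry.HodgeTheory (leftIso' twistHodgePushforwardIso twistJetPushforwardIso
  twistJetPushforwardHom twistJetPushforwardHom_app_apply TwistJetSections twistHodge twistJetModule twistJetι twistJetπ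
  toTwistHodgeZero map_toTwistHodgeZero_comp map_twistJetι_comp_twistJetPushforwardIso_hom
  map_twistJetπ_comp_twistHodgePushforwardIso_hom)

variable {S : Type u} [CommRing S] {X₀ X₁ : Over (Spec (CommRingCat.of S))} (e : X₀ ≅ X₁)

/-! ## §1 Naturality in `E` of the module-level comparisons -/

section ModuleLevel

variable {E₁ E₂ : X₀.left.Modules} (g : E₁ ⟶ E₂)

/-- **Naturality of `e_*(E^∨) ≅ (e_*E)^∨` in `E`**: `e_*(gᵗ) ≫ (iso E₁).hom = (iso E₂).hom ≫ (e_* g)ᵗ` (transposes are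
`𝓗om(–, 𝒪)`; `sheafHomPushforwardIso` is natural in both variables and the unit `ε♯` is absorbed by the exchange law).
[cite: Hartshorne1977, II §5 pp. 109–110 (the sheaf Hom and direct images f_*; reading: bookkeeping along an isomorphism of schemes)] -/
theorem map_dualMap_comp_dualPushforwardIso_hom :
    (pushforward e.hom.left).map (sheafHomMapLeft g (unitModule X₀.left)) ≫ (dualPushforwardIso (leftIso' e) E₁).hom =
      (dualPushforwardIso (leftIso' e) E₂).hom ≫
        sheafHomMapLeft ((pushforward e.hom.left).map g) (unitModule X₁.left) := by
  simp only [dualPushforwardIso, Iso.trans_hom, Functor.mapIso_hom, Iso.symm_hom, sheafHomFunctor_map, Category.assoc]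
  rw [← Category.assoc]
  erw [sheafHomPushforwardIso_hom_naturality_left (leftIso' e) g (unitModule X₀.left)]
  rw [Category.assoc, sheafHomMapLeft_sheafHomMap]

/-- **Naturality of `α_j : e_*(E ⊗ Ωʲ) ≅ e_*E ⊗ Ωʲ` in `E`**: `e_*(g ⊗ 1) ≫ α_j(E₂) = α_j(E₁) ≫ (e_* g ⊗ 1)`.
[cite: Hartshorne1977, II Ex. 5.1 (b) and II §5 pp. 109–110 (𝓗om(E^∨, G) ≅ E ⊗ G, direct images; reading: bookkeeping along an isomorphism of schemes)] -/
theorem map_twistHodgeFunctor_map_comp_twistHodgePushforwardIso_hom (j : ℕ) :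
    (pushforward e.hom.left).map ((twistHodgeFunctor X₀ j).map g) ≫ (twistHodgePushforwardIso e E₂ j).hom =
      (twistHodgePushforwardIso e E₁ j).hom ≫ (twistHodgeFunctor X₁ j).map ((pushforward e.hom.left).map g) := by
  change (pushforward e.hom.left).map (sheafHomMapLeft (sheafHomMapLeft g (unitModule X₀.left)) (hodgeSheaf X₀ j)) ≫ _ =
    _ ≫ sheafHomMapLeft (sheafHomMapLeft ((pushforward e.hom.left).map g) (unitModule X₁.left)) (hodgeSheaf X₁ j)
  simp only [twistHodgePushforwardIso, sheafHomDualPushforwardIso, Iso.trans_hom, Functor.mapIso_hom, Iso.symm_hom,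
    sheafHomFunctor_map, sheafHomMapLeftIso_hom, Category.assoc]
  rw [← Category.assoc]
  erw [sheafHomPushforwardIso_hom_naturality_left (leftIso' e) (sheafHomMapLeft g (unitModule X₀.left)) (hodgeSheaf X₀ j)]
  rw [Category.assoc]
  congr 1
  rw [← sheafHomMapLeft_sheafHomMap (hodgeSheaf X₁ j) (sheafHomMapLeft ((pushforward e.hom.left).map g) (unitModule X₁.left))
    (Literature.AlgebraicGeometry.HodgeTheory.hodgeSheaf.comapIso e j).inv, ← Category.assoc, ← Category.assoc,
    ← sheafHomMapLeft_comp, ← sheafHomMapLeft_comp]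
  congr 2
  rw [Iso.inv_comp_eq, ← Category.assoc, Iso.eq_comp_inv]
  exact map_dualMap_comp_dualPushforwardIso_hom e g

/-- **Naturality of `e_* Pʲ(E) ≅ Pʲ(e_* E)` in `E`**: `e_*(Pʲ(g)) ≫ iso(E₂) = iso(E₁) ≫ Pʲ(e_* g)` (componentwise the naturality of
`α_j`, `α_{j+1}` on sections). [cite: Atiyah1957, §4 Prop. 6 (functoriality of the jet module; reading: compatible with an isomorphism of the ambient scheme)] -/
theorem map_twistJetFunctor_map_comp_twistJetPushforwardIso_hom (j : ℕ) :
    (pushforward e.hom.left).map ((twistJetFunctor X₀ j).map g) ≫ (twistJetPushforwardIso e E₂ j).hom =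
      (twistJetPushforwardIso e E₁ j).hom ≫ (twistJetFunctor X₁ j).map ((pushforward e.hom.left).map g) := by
  have h₁ := map_twistHodgeFunctor_map_comp_twistHodgePushforwardIso_hom e g j
  have h₂ := map_twistHodgeFunctor_map_comp_twistHodgePushforwardIso_hom e g (j + 1)
  refine Scheme.Modules.hom_ext _ _ fun U => AddCommGrpCat.ext fun (p : TwistJetSections E₁ j (e.hom.left ⁻¹ᵁ U)) => ?_
  have h₁' := congrArg (fun φ => φ.app U p.fst) h₁
  have h₂' := congrArg (fun φ => φ.app U p.snd) h₂
  simp only [Scheme.Modules.Hom.comp_app, pushforward_map_app, twistFunctor_map] at h₁' h₂'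
  change (twistJetPushforwardIso e E₂ j).hom.app U ((twistJetMap g j).app (e.hom.left ⁻¹ᵁ U) p) =
    (twistJetMap ((pushforward e.hom.left).map g) j).app U ((twistJetPushforwardIso e E₁ j).hom.app U p)
  simp only [twistJetPushforwardIso, asIso_hom, twistJetPushforwardHom_app_apply, twistJetMap_app_apply]
  exact TwistJetSections.ext h₁' h₂'

end ModuleLevel

/-! ## §2 The chain isomorphisms and the morphism of termwise twisted Atiyah sequences -/

section ChainLevel

variable (j : ℕ) (K : CochainComplex X₀.left.Modules ℤ)

/-- **`e_*•(K ⊗ Ωʲ) ≅ (e_*•K) ⊗ Ωʲ`** termwise `α_j` (a chain isomorphism by naturality of `α_j`). [cite: BuchweitzFlenner2003, §3 (Atiyah class of a complex; reading: compatible with an isomorphism of the ambient scheme)] -/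
def twistHodgeComplexPushforwardIso :
    ((pushforward e.hom.left).mapHomologicalComplex (ComplexShape.up ℤ)).obj (twistHodgeComplex X₀ j K) ≅
      twistHodgeComplex X₁ j (((pushforward e.hom.left).mapHomologicalComplex (ComplexShape.up ℤ)).obj K) :=
  HomologicalComplex.Hom.isoOfComponents (fun i => twistHodgePushforwardIso e (K.X i) j) fun i i' _ =>
    (map_twistHodgeFunctor_map_comp_twistHodgePushforwardIso_hom e (K.d i i') j).symm

/-- Components of `twistHodgeComplexPushforwardIso`. [folklore] -/
@[simp]
theorem twistHodgeComplexPushforwardIso_hom_f (i : ℤ) :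
    (twistHodgeComplexPushforwardIso e j K).hom.f i = (twistHodgePushforwardIso e (K.X i) j).hom := rfl

/-- **`e_*• Pʲ(K) ≅ Pʲ(e_*•K)`** termwise (a chain isomorphism by naturality of the jet comparison). [cite: BuchweitzFlenner2003, §3 (Atiyah class of a complex; reading: compatible with an isomorphism of the ambient scheme)] -/
def twistJetComplexPushforwardIso :
    ((pushforward e.hom.left).mapHomologicalComplex (ComplexShape.up ℤ)).obj
        (((twistJetFunctor X₀ j).mapHomologicalComplex (ComplexShape.up ℤ)).obj K) ≅
      ((twistJetFunctor X₁ j).mapHomologicalComplex (ComplexShape.up ℤ)).obj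
        (((pushforward e.hom.left).mapHomologicalComplex (ComplexShape.up ℤ)).obj K) :=
  HomologicalComplex.Hom.isoOfComponents (fun i => twistJetPushforwardIso e (K.X i) j) fun i i' _ =>
    (map_twistJetFunctor_map_comp_twistJetPushforwardIso_hom e (K.d i i') j).symm

/-- Components of `twistJetComplexPushforwardIso`. [folklore] -/
@[simp]
theorem twistJetComplexPushforwardIso_hom_f (i : ℤ) :
    (twistJetComplexPushforwardIso e j K).hom.f i = (twistJetPushforwardIso e (K.X i) j).hom := rfl

/-- **The morphism of termwise twisted Atiyah sequences** `e_*•(0 → K⊗Ωʲ⁺¹ → Pʲ(K) → K⊗Ωʲ → 0) ⟶ (0 → K'⊗Ωʲ⁺¹ → Pʲ(K') → K'⊗Ωʲ → 0)`,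
`K' = e_*•K`, with the three chain isomorphisms above (compatibility with `ι`, `π` termwise:
`map_twistJetι_comp_twistJetPushforwardIso_hom`, `map_twistJetπ_comp_twistHodgePushforwardIso_hom`). [cite: BuchweitzFlenner2003, §3 (Atiyah class of a complex; reading: compatible with an isomorphism of the ambient scheme)] -/
def twistJetComplexShortComplexPushforwardHom :
    (twistJetComplexShortComplex X₀ j K).map ((pushforward e.hom.left).mapHomologicalComplex (ComplexShape.up ℤ)) ⟶
      twistJetComplexShortComplex X₁ j (((pushforward e.hom.left).mapHomologicalComplex (ComplexShape.up ℤ)).obj K) where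
  τ₁ := (twistHodgeComplexPushforwardIso e (j + 1) K).hom
  τ₂ := (twistJetComplexPushforwardIso e j K).hom
  τ₃ := (twistHodgeComplexPushforwardIso e j K).hom
  comm₁₂ := by
    refine HomologicalComplex.hom_ext _ _ fun i => ?_
    change (twistHodgePushforwardIso e (K.X i) (j + 1)).hom ≫ twistJetι ((pushforward e.hom.left).obj (K.X i)) j =
      (pushforward e.hom.left).map (twistJetι (K.X i) j) ≫ (twistJetPushforwardIso e (K.X i) j).hom
    exact (map_twistJetι_comp_twistJetPushforwardIso_hom e (K.X i) j).symm
  comm₂₃ := by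
    refine HomologicalComplex.hom_ext _ _ fun i => ?_
    change (twistJetPushforwardIso e (K.X i) j).hom ≫ twistJetπ ((pushforward e.hom.left).obj (K.X i)) j =
      (pushforward e.hom.left).map (twistJetπ (K.X i) j) ≫ (twistHodgePushforwardIso e (K.X i) j).hom
    exact (map_twistJetπ_comp_twistHodgePushforwardIso_hom e (K.X i) j).symm

end ChainLevel

/-! ## §3 The Atiyah steps and powers along `e_{**}` -/

section Derived

variable [HasDerivedCategory.{w₀} X₀.left.Modules] [HasDerivedCategory.{w₁} X₁.left.Modules]
  (j : ℕ) (K : CochainComplex X₀.left.Modules ℤ)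

/-- **`e_{**}(At_j(K)) = δ(e_*•(0 → K⊗Ωʲ⁺¹ → Pʲ(K) → K⊗Ωʲ → 0))`**: an exact functor maps the connecting morphism of a short exact
sequence of complexes to that of its image (Mathlib `DerivedCategory.map_triangleOfSESδ`; all factorisation isomorphisms cancel).
[cite: Weibel1994, §10.4 and Example 10.4.9] -/
theorem mapShiftedHom_complexAtiyahStep :
    mapShiftedHom (pushforward e.hom.left) (complexAtiyahStep X₀ j K) =
      triangleOfSESδ ((twistJetComplexShortComplex_shortExact (X := X₀) j K).map_of_exact
        ((pushforward e.hom.left).mapHomologicalComplex (ComplexShape.up ℤ))) := by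
  unfold mapShiftedHom
  rw [complexAtiyahStep, ShiftedHom.map,
    DerivedCategory.map_triangleOfSESδ (pushforward e.hom.left) (twistJetComplexShortComplex_shortExact (X := X₀) j K)]
  simp only [Category.assoc]
  erw [Iso.inv_hom_id_app_assoc, Iso.inv_hom_id_app_assoc, ← Functor.map_comp, Iso.inv_hom_id_app,
    CategoryTheory.Functor.map_id, Category.comp_id]

/-- **`e_{**}(At_j(K)) · [Q α_{j+1}] = [Q α_j] · At_j(e_*•K)`** (naturality of the connecting morphism along the morphism of twisted
Atiyah sequences of §2). [cite: BuchweitzFlenner2003, §3 (Atiyah class of a complex; reading: compatible with an isomorphism of the ambient scheme)] -/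
theorem mapShiftedHom_complexAtiyahStep_comp :
    (mapShiftedHom (pushforward e.hom.left) (complexAtiyahStep X₀ j K)).comp
        (ShiftedHom.mk₀ (0 : ℤ) rfl (Q.map (twistHodgeComplexPushforwardIso e (j + 1) K).hom)) (zero_add 1) =
      (ShiftedHom.mk₀ (0 : ℤ) rfl (Q.map (twistHodgeComplexPushforwardIso e j K).hom)).comp
        (complexAtiyahStep X₁ j (((pushforward e.hom.left).mapHomologicalComplex (ComplexShape.up ℤ)).obj K)) (add_zero 1) := by
  rw [ShiftedHom.comp_mk₀, ShiftedHom.mk₀_comp, mapShiftedHom_complexAtiyahStep]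
  exact DerivedCategory.triangleOfSESδ_naturality _ (twistJetComplexShortComplex_shortExact (X := X₁) j _)
    (twistJetComplexShortComplexPushforwardHom e j K)

/-- **`e_{**}(At(K)^q) · [Q α_q] = [Q α_0] · At(e_*•K)^q`** (induction on `q`: `e_{**}` is multiplicative, `mapShiftedHom_comp`).
[cite: BuchweitzFlenner2003, Def. 4.1 (powers of the Atiyah class; reading: compatible with an isomorphism of the ambient scheme)] -/
theorem mapShiftedHom_complexAtiyahPower_comp (q : ℕ) :
    (mapShiftedHom (pushforward e.hom.left) (complexAtiyahPower X₀ K q)).comp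
        (ShiftedHom.mk₀ (0 : ℤ) rfl (Q.map (twistHodgeComplexPushforwardIso e q K).hom)) (zero_add _) =
      (ShiftedHom.mk₀ (0 : ℤ) rfl (Q.map (twistHodgeComplexPushforwardIso e 0 K).hom)).comp
        (complexAtiyahPower X₁ (((pushforward e.hom.left).mapHomologicalComplex (ComplexShape.up ℤ)).obj K) q) (add_zero _) := by
  induction q with
  | zero =>
    rw [complexAtiyahPower_zero, complexAtiyahPower_zero]
    erw [ShiftedHom.comp_mk₀_id]
    rw [← (Q (C := X₀.left.Modules)).map_id]
    erw [mapShiftedHom_mk₀]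
    rw [CategoryTheory.Functor.map_id, CategoryTheory.Functor.map_id]
    erw [ShiftedHom.mk₀_id_comp]
  | succ q ih =>
    rw [complexAtiyahPower_succ, complexAtiyahPower_succ, mapShiftedHom_comp, shiftedHom_comp_comp_mk₀,
      mapShiftedHom_complexAtiyahStep_comp, ← shiftedHom_comp_mk₀_comp, ih, shiftedHom_mk₀_comp_comp]

end Derived

/-! ## §4 `ι•` and the argument of `σ_q` along `e_{**}` -/

section Iota

variable (K : CochainComplex X₀.left.Modules ℤ)

/-- **`e_*•(ι•_K) ≫ α_0 = ι•_{e_*•K}`** (termwise `map_toTwistHodgeZero_comp`). [cite: Hartshorne1977, II Ex. 5.1 (a), (b) (E → E^∨∨, 𝓗om(E^∨, G) ≅ E ⊗ G; reading: bookkeeping along an isomorphism of schemes)] -/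
theorem map_toTwistHodgeZeroC_comp :
    ((pushforward e.hom.left).mapHomologicalComplex (ComplexShape.up ℤ)).map (toTwistHodgeZeroC X₀ K) ≫
        (twistHodgeComplexPushforwardIso e 0 K).hom =
      toTwistHodgeZeroC X₁ (((pushforward e.hom.left).mapHomologicalComplex (ComplexShape.up ℤ)).obj K) := by
  refine HomologicalComplex.hom_ext _ _ fun i => ?_
  rw [HomologicalComplex.comp_f, Functor.mapHomologicalComplex_map_f, twistHodgeComplexPushforwardIso_hom_f,
    toTwistHodgeZeroC_f, toTwistHodgeZeroC_f]
  exact map_toTwistHodgeZero_comp e (K.X i)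

variable [HasDerivedCategory.{w₀} X₀.left.Modules] [HasDerivedCategory.{w₁} X₁.left.Modules]

/-- **`e_{**}(ι• · At(K)^q) · [Q α_q] = ι• · At(e_*•K)^q`** (for the composite `complexAtiyahPowerFrom`).
[cite: BuchweitzFlenner2003, Def. 4.1 (reading: compatible with an isomorphism of the ambient scheme)] -/
theorem mapShiftedHom_complexAtiyahPowerFrom_comp (q : ℕ) :
    (mapShiftedHom (pushforward e.hom.left) (complexAtiyahPowerFrom q K)).comp
        (ShiftedHom.mk₀ (0 : ℤ) rfl (Q.map (twistHodgeComplexPushforwardIso e q K).hom)) (zero_add _) =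
      complexAtiyahPowerFrom q (((pushforward e.hom.left).mapHomologicalComplex (ComplexShape.up ℤ)).obj K) := by
  rw [complexAtiyahPowerFrom, complexAtiyahPowerFrom, mapShiftedHom_mk₀_comp, shiftedHom_mk₀_comp_comp,
    mapShiftedHom_complexAtiyahPower_comp, ← shiftedHom_mk₀_comp_comp, ShiftedHom.mk₀_comp_mk₀, ← Functor.map_comp,
    map_toTwistHodgeZeroC_comp]

/-- **The argument of `σ_q` along `e_{**}`**: `e_{**}(x · ι• · At(K)^q) · [Q α_q] = e_{**}(x) · ι• · At(e_*•K)^q` for every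
`x ∈ Ext²(K, K) = Hom_D(Q K, (Q K)⟦2⟧)`. [cite: BuchweitzFlenner2003, Def. 4.1 (reading: compatible with an isomorphism of the ambient scheme)] -/
theorem mapShiftedHom_extMulAtiyahPower_comp (q : ℕ) (x : ShiftedHom (Q.obj K) (Q.obj K) (2 : ℤ)) :
    (mapShiftedHom (pushforward e.hom.left) (extMulAtiyahPower X₀ K q x)).comp
        (ShiftedHom.mk₀ (0 : ℤ) rfl (Q.map (twistHodgeComplexPushforwardIso e q K).hom)) (zero_add _) =
      extMulAtiyahPower X₁ (((pushforward e.hom.left).mapHomologicalComplex (ComplexShape.up ℤ)).obj K) q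
        (mapShiftedHom (pushforward e.hom.left) x) := by
  rw [extMulAtiyahPower_eq_comp, extMulAtiyahPower_eq_comp, mapShiftedHom_comp, shiftedHom_comp_comp_mk₀,
    mapShiftedHom_complexAtiyahPowerFrom_comp]

end Iota

end Summit.Ventures.HSemireg

end
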